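import Summits.AnomalousDissipation.AnomalousDissipation.Theses.TwoAndHalfD
import Literature.Analysis.FluidPDE.TwoHalfNavierStokes
import Literature.Analysis.FluidPDE.LongTimeAverageNonneg
import Literature.Barriers.AnomalousDissipation.SingleShellEnstrophyBoundMean
import Summits.AnomalousDissipation.AnomalousDissipation.Theorems.TwoAndHalfDTwohalfdThesisStubShellNoGo

/-!
# Stub `stub_subLogStrain_singleShell` (S6-mono) of the line `log-kantorovich-enstrophy-transfer`
# for the crux `TwoAndHalfD.TwohalfdNeg` (stmt-AnomalousDissipation-0211): the monoscale residual

`SubLogStrain` on the MONOSCALE class: for a smooth divergence-free mean-zero steady force `g` on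
`T²` whose Fourier coefficients live on ONE shell `|k|² = m` (`m ∈ ℝ` arbitrary; for `m ≤ 0` the
force vanishes), every bounded-energy family of global Leray–Hopf solutions `v_j` (viscosities
`ν_j > 0`, `ν_j → 0`, arbitrary `L²` data, `sup_j ⟨‖v_j‖₂²⟩ ≤ E`) has sub-logarithmic mean strain,
`⟨‖∇v_j‖₂⟩ / log(1/ν_j) → 0` — in fact the honest `limsup` mean strain is bounded uniformly in `j`.

Proof. (1) Tran–Shepherd's dynamical constraint in the long-time mean, all shells and all data
(`Literature.Barriers.AnomalousDissipation.singleShell_meanEnstrophy_le_max`, Tran–Shepherd 2002 §4,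
Alexakis–Doering 2006 §4 `ε ≤ νk_f²U²`): `⟨‖∇v_j‖₂²⟩ ≤ 4π² max(m,0) ⟨‖v_j‖₂²⟩ ≤ 4π² max(m,0) max(E,0) =: B`.
(2) Jensen in the running mean plus honest `limsup` bookkeeping (the running means of the enstrophy
are bounded at fixed `ν_j` for a mean-zero force), in the form already landed for the sibling crux
(`TwohalfdThesis.longTimeAvgSup_sqrt_le_sqrt_add_one`): `⟨‖∇v_j‖₂⟩ ≤ √(B + 1)` for every `j`.
(3) `log(1/ν_j) → +∞` as `ν_j → 0⁺`, so `√(B+1)/log(1/ν_j) → 0`; squeeze with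
`0 ≤ ⟨‖∇v_j‖₂⟩/log(1/ν_j)` once `log(1/ν_j) ≥ 0`.
Supports stmt-AnomalousDissipation-0211 (feeds `twohalfdNeg_twoHalf_singleShell_of` of the skeleton
`Cruxes/TwohalfdNeg/Lines/log_kantorovich_enstrophy_transfer.lean`).

References: C. V. Tran, T. G. Shepherd, Physica D 165 (2002) §4; A. Alexakis, C. R. Doering,
Phys. Lett. A 359 (2006) §4.
-/

namespace Summit.AnomalousDissipation.AnomalousDissipation.Theorems.TwohalfdNeg.SubLogStrainSingleShell

open MeasureTheory Filter Topology
open scoped ENNReal NNReal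
open Literature.Analysis.FunctionSpaces Literature.Analysis.FluidPDE

set_option linter.dupNamespace false

/-- **S6-mono `stub_subLogStrain_singleShell` — `SubLogStrain` holds for single-shell forcing.**
For a smooth divergence-free mean-zero steady `g` on `T²` with Fourier support on ONE shell
`|k|² = m`, viscosities `ν_j > 0` with `ν_j → 0`, and global Leray–Hopf `v_j` forced by `g` with
`sup_j ⟨‖v_j‖₂²⟩ < ∞`: `⟨‖∇v_j‖₂⟩ / log(1/ν_j) → 0`. Tran–Shepherd's mean dynamical constraint
`⟨‖∇v_j‖₂²⟩ ≤ 4π² max(m,0) ⟨‖v_j‖₂²⟩` (`singleShell_meanEnstrophy_le_max`), Jensen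
(`TwohalfdThesis.longTimeAvgSup_sqrt_le_sqrt_add_one`) for the `j`-uniform strain ceiling
`√(4π² max(m,0) max(E,0) + 1)`, and `log(1/ν_j) → +∞`. -/
theorem stub_subLogStrain_singleShell :
    ∀ g : UnitAddTorus (Fin 2) → EuclideanSpace ℝ (Fin 2),
      Torus.IsSmooth g → Torus.IsDivFree g → Torus.HasZeroMean g →
      (∃ m : ℝ, ∀ k : Fin 2 → ℤ, Torus.freqNormSq k ≠ m →
        UnitAddTorus.mFourierCoeff (EuclideanSpace.complexify ∘ g) k = 0) →
      ∀ (ν : ℕ → ℝ) (v₀ : ℕ → UnitAddTorus (Fin 2) → EuclideanSpace ℝ (Fin 2))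
        (v : ℕ → ℝ → UnitAddTorus (Fin 2) → EuclideanSpace ℝ (Fin 2)),
        (∀ j, 0 < ν j) → Tendsto ν atTop (𝓝 0) →
        (∀ j, Torus.IsGlobalLerayHopf (ν j) (fun _ => g) (v₀ j) (v j)) →
        (∃ E : ℝ, ∀ j, meanEnergy (v j) ≤ E) →
        Tendsto (fun j => longTimeAvgSup (fun t => Real.sqrt (Torus.eGradNormSq (v j t)).toReal) /
          Real.log (ν j)⁻¹) atTop (𝓝 0) := by
  intro g hgs hgd hgz hshell ν v₀ v hν hν0 hLH hE
  obtain ⟨m, hm⟩ := hshell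
  obtain ⟨E, hE⟩ := hE
  -- (1) the `j`-uniform mean-enstrophy ceiling `B` (Tran–Shepherd's constraint in the mean)
  set B : ℝ := 4 * Real.pi ^ 2 * max m 0 * max E 0 with hB
  have hZ : ∀ j, longTimeAvgSup (fun t => (Torus.eGradNormSq (v j t)).toReal) ≤ B := fun j =>
    (Literature.Barriers.AnomalousDissipation.singleShell_meanEnstrophy_le_max (hν j) hgs hgd hgz hm
      (hLH j)).trans
      (mul_le_mul_of_nonneg_left ((hE j).trans (le_max_left _ _)) (by positivity))
  -- (2) Jensen: the `j`-uniform mean-strain ceiling `√(B + 1)`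
  have hN : ∀ j, longTimeAvgSup (fun t => Real.sqrt (Torus.eGradNormSq (v j t)).toReal) ≤
      Real.sqrt (B + 1) := fun j =>
    Summit.AnomalousDissipation.AnomalousDissipation.Theorems.TwohalfdThesis.longTimeAvgSup_sqrt_le_sqrt_add_one
      (hν j) (hgs.memLp 2) hgz (hLH j) (hZ j)
  -- (3) `log(1/ν_j) → +∞`, squeeze
  have hν0' : Tendsto ν atTop (𝓝[>] 0) :=
    tendsto_nhdsWithin_iff.2 ⟨hν0, Eventually.of_forall fun j => hν j⟩
  have hℓtop : Tendsto (fun j => Real.log (ν j)⁻¹) atTop atTop :=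
    Real.tendsto_log_atTop.comp (tendsto_inv_nhdsGT_zero.comp hν0')
  have hup : Tendsto (fun j => Real.sqrt (B + 1) / Real.log (ν j)⁻¹) atTop (𝓝 0) :=
    tendsto_const_nhds.div_atTop hℓtop
  refine squeeze_zero' ?_ ?_ hup
  · filter_upwards [hℓtop.eventually_ge_atTop 0] with j hj
    exact div_nonneg (longTimeAvgSup_nonneg fun _ => Real.sqrt_nonneg _) hj
  · filter_upwards [hℓtop.eventually_ge_atTop 0] with j hj
    exact div_le_div_of_nonneg_right (hN j) hj

end Summit.AnomalousDissipation.AnomalousDissipation.Theorems.TwohalfdNeg.SubLogStrainSingleShell
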